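import Summits.QuantumFields.BalabanUV.T4Continuum.Spine.NE1p.DressedTowerWitnessBlocks

/-!
# T⁴ programme, spine estimate NE1′ (node O3b/H2) — THE BLOCK GEOMETRY ACTS, part 2 of 2: the integer window `81 ≤ Lb ≤ 120`, the
# derived positional count ATTAINED, and the canonical terminal face S3l APPLIED to the `Lb⁴`-family tower at every integer of the
# window (swarm witness «W14» of `t4/formal/NE1p/LEAVES.md`, INTENT CLAIMS.log l.11641) [decided toy]

Cell `pub-balaban`, sub-cell `t4`, BINDER-OWNERS row NE1′ (owner lineage t4-ne1p-p1); formalisation crew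
`b2b-balaban-t4-ne1p-formalise-*`, seat `…-leaf-09` (gen 4).  ADDITIVE — imports part 1 `Spine/NE1p/DressedTowerWitnessBlocks` ONLY (through
it leaf-02-g4's W11r part 1 `DressedTerminalWitnessReuse` p216180 — whose integer-window arithmetic is used BY NAME, nothing duplicated
(typer R-T61 (ii)(a)) —, S3l p215128, W7-2 p214558, S3c p213339); modifies nothing.  One design with part 1.
CREDIT.  The integer-window sizing («reuse W7's function-level data below `LW`; (w6)+(w7) ⟹ `81 ≤ L ≤ 120` at `s̄⁰ = 0`, `m = ¼`»)
is leaf-02-g4's (CLAIMS.log l.11450 ∕ l.11576; kernel: W11r) and leaf-07-g5's (l.11470; sharp form: their row S3c.1 «LF-4 EXACT»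
p216101), adopted by the typer (R-T58 (ii) ∕ R-T59 (iii)); this seat's LF-4 observation l.11316 posed the integer question.

CONTENTS.
* §1 the window [arith], W11r's BY NAME: `hloc_int : locCell Lb 2 0 ½ ≤ ¾` for `81 ≤ Lb` (`e³ < 20.09`, S3c), (w6) `hsmall_int` with
  EQUALITY, RATE DOMINATION `natL_le_LW` ∕ `psi_le_psiL` ∕ `tau_pow_le` (`Lb ≤ 120 < LW`, `e³ > 20.08`) — whence W7's defects and dressing
  meet the face's UPPER-bound binders at the cell's rates (`hrateT`, `tau_pow_le`; here only `hδfP`, the fresh defect over THIS toy's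
  `Lb⁴`-term live generations, is new).
* §2 **the derived count, attained** [decided toy]: `count_derived` = the (w3-book) bound the terminal face reads off part 1's
  anchoring through rows S4 ∕ S3i's `count_of_anchoring_cell` BY NAME (`#{live families of birth scale j in the component at k}
  ≤ 1·(Lb⁴)^{k−j}`), and `count_attained`: at `k = 1`, `j = 0` the left side IS `Lb⁴ = 1·(Lb⁴)^{1−0}` — EQUALITY; the block
  geometry is used at full strength.
* §3 **`dressedStabilityWith_towerP_fires`**: for EVERY integer `81 ≤ Lb ≤ 120`, `DressedStabilityWith (towerP Lb) 1 (rhoOne Lb⁻² 2 0 ½)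
  Lb⁻³` by ONE application of S3l's `dressedStabilityWith_of_canonicalSliceWinSchedules` — its ≈ 50 `(a, K)`-indexed binder families
  inhabited AT ONCE by part 1 (anchoring with coarsening, housing of `Lb⁴` families, the `Lb⁴`-term dictionary, the booking
  convention) and W7's per-family lemmas BY NAME; **`dressedStability_towerP_fires : DressedStability (towerP Lb)`**; ROOT-B
  **`dressedBudget_towerP_fires : DressedBudget (towerP Lb) wt`** by S3l's `dressedBudget_of_canonicalSliceWinSchedules` BY NAME (the
  SAME anchoring read as the bookings' positional count — here with `Lb⁴` families felt per cube); `sizeBound_towerP_fires` (END's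
  consumer face); endpoint `example`s at `Lb = 81`, `Lb = 120`.

LIVE vs ≡ 0 (R-T56 (h) (2)).  LIVE by computation: positive sizes ∕ `lin` ∕ `gen` of `Lb⁴` families at every `(K, k)`; the block
geometry (coarsening, `mB = 1` by injectivity, housing, `#S k b = Lb⁴`, the derived count ATTAINED); the `Lb⁴`-term dictionary `hQ`
(EQUATION) and the weighted two-point step law `hFn` (EQUATION, W7's) for every family; fresh pairs for every live generation;
`hcm`; the booking convention (increment set bounded, `lin` attained); the absorption door and `hβ` at `K = 0` (EQUALITY); (w6)
`hsmall` (EQUALITY).  DECLARED ≡ 0: `𝒜 ≡ 0` (`hB`∕`hE` constants — live in W9 ∕ W12), `s ≡ 0`, `creg ≡ 0` (live in W10),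
`Sabs ≡ ∅` (live in W13), `rel = Eq`.

HONEST FRAMING.  A decided toy ([folklore]; 0 sorry; 0 citations; no `def`, no `def … : Prop`); NOTHING of Bałaban's localisation
domains, large-field components, D-terms or windows is modelled or asserted; `Lb` is the cell's integer in `[81, 120]` and `Λ = Lb⁴`
the count constant OF THE TOY — kernel consequences of `locCell` ∕ (w6) ∕ `LW`, never «Bałaban's L» (k2).  Headline (c4): «the canonical terminal face S3l FIRES, at every integer
blocking factor 81 ≤ Lb ≤ 120, on a decided toy whose (w3-book) block geometry ACTS — Lb⁴ families coarsened into one met component,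
the derived positional count attained, an Lb⁴-term live dictionary; non-vacuity of SHAPES only — NE1′ ⇐ the named binders, NOT
proved, NOT printed; 0 binders instantiated on Bałaban's densities»; spine PROVED 0∕9.  Rung (B)+1 on ONE finite four-torus — NOT
infinite volume, NOT a mass gap, NOT OS on ℝ⁴, NOT Clay, NOT summit progress.  HONEST DEPENDENCY: continuum YM on T⁴ ⇐ BetaPertH ∧
nine spine estimates (0/9 proved); BetaPertH ⇐ (D1) ∧ (D4) ∧ CAP+tail; G-an2-4 gates asym, D1 and NE2/3/4.
-/

noncomputable section

namespace Summit.QuantumFields.BalabanUV.T4Continuum.NE1p.DressedTowerWitnessBlocks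

open MeasureTheory Set Metric Filter Finset
open scoped BigOperators
open Literature.MathematicalPhysics.QuantumFieldTheory.Balaban1983to89
open Literature.MathematicalPhysics.QuantumFieldTheory.Balaban1983to89.T4TermFormat
open Literature.MathematicalPhysics.QuantumFieldTheory.Balaban1983to89.T4TermFormat.Booking
open Literature.MathematicalPhysics.QuantumFieldTheory.Balaban1983to89.T4FeltGeometry
open Literature.MathematicalPhysics.QuantumFieldTheory.Balaban1983to89.T4GatedBooking
open Literature.MathematicalPhysics.QuantumFieldTheory.Balaban1983to89.T4TrajectoryComparison
open T4TrajectoryModulus (bondBall bondBall_add_mem bondBall_latMove_add_mem bondBall_diam)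
open T4BlockTransport (Fld NDir latMove latN Site norm_dir_le)
open T4BirthChartTransport (GaugeInvariant BirthSlice RelGauge)
open T4TrajectoryDensity
open Summit.QuantumFields.BalabanUV.T4Continuum.T4TrajectoryDensityDressed
open Summit.QuantumFields.BalabanUV.T4Continuum.T4TrajectoryDensityWitness
open Summit.QuantumFields.BalabanUV.T4Continuum.NE1p.DressedRoot
open Summit.QuantumFields.BalabanUV.T4Continuum.NE1p.DressedUniformConstants
open Summit.QuantumFields.BalabanUV.T4Continuum.NE1p.DressedWindowScheduleWin
open Summit.QuantumFields.BalabanUV.T4Continuum.NE1p.DressedWindowScheduleModWin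
open Summit.QuantumFields.BalabanUV.T4Continuum.NE1p.DressedTowerWitness
open Summit.QuantumFields.BalabanUV.T4Continuum.NE1p.DressedTowerWitnessSlice
open Summit.QuantumFields.BalabanUV.T4Continuum.NE1p.DressedAbsorptionWindow
open Summit.QuantumFields.BalabanUV.T4Continuum.NE1p.DressedCellNecessity
open Summit.QuantumFields.BalabanUV.T4Continuum.NE1p.DressedStabilityOfSuppliedSchedules
open Summit.QuantumFields.BalabanUV.T4Continuum.NE1p.DressedStabilityOfCanonicalSliceWinSchedules
open Summit.QuantumFields.BalabanUV.T4Continuum.NE1p.DressedTerminalWitnessReuse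

/-! ## §1 The fresh defect at the cell's rate (the rest of the window arithmetic is W11r's, BY NAME) [arith] -/

/-- `hδf` (I4′) AT THE CELL's RATE, for every live generation of the `Lb⁴`-family component [decided toy]: W7's fresh defect
`ψ_W^{k+1}∕4 ≤ ½·ψ_W^{k}` (`hδfM`) `≤ ½·(Lb⁻²)^{k}` (W11r's `psi_le_psiL`; every live generation has scale `0`). [folklore] -/
theorem hδfP {Lb : ℕ} (h81 : 81 ≤ Lb) (h120 : Lb ≤ 120) (K : ℕ) :
    ∀ (k : ℕ) (b : Blk Lb), ∀ p ∈ SgP K Lb k b, 0 ≤ dfW k ∧ dfW k ≤ 1 / 2 * (((Lb : ℝ) ^ 2)⁻¹) ^ (k - p.2) := by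
  intro k b p hp
  obtain ⟨_, h2⟩ := mem_SgP hp
  rw [h2]
  have h := hδfM K k () ((), 0) (Finset.mem_singleton_self _)
  exact ⟨h.1, h.2.trans (mul_le_mul_of_nonneg_left (pow_le_pow_left₀ psi_pos.le (psi_le_psiL h81 h120) _) (by norm_num))⟩

/-! ## §2 The positional count the terminal face derives from the anchoring — and its attainment [decided toy] -/

/-- **THE DERIVED COUNT** [bookkeeping on the toy]: what the terminal face reads off part 1's anchoring through rows S4 ∕ S3i's
`count_of_anchoring_cell` BY NAME — the live families of the met component are born (`hS`) and positionally counted by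
`1·(Lb⁴)^{k−j}` (`hcount`, `N₀ = v·mB = 1`, `Λ = Lb⁴`).  Nothing is supplied by hand: the block geometry does the counting. [folklore] -/
theorem count_derived (K : ℕ) {Lb : ℕ} (hLb : 1 ≤ Lb) :
    (∀ k b, ∀ f ∈ SP K Lb k b, (BP K Lb).birthScale f ≤ k) ∧
      ∀ k b, ∀ j ≤ k, (((SP K Lb k b).filter fun f => (BP K Lb).birthScale f = j).card : ℝ) ≤ 1 * ((Lb : ℝ) ^ 4) ^ (k - j) :=
  count_of_anchoring_cell (anchP K Lb) rfl (by exact_mod_cast hLb) (hmultP K Lb) (hscaleP K Lb) (hhousedP K Lb) (hvolP K Lb)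
    (by norm_num)

/-- **THE DERIVED COUNT IS ATTAINED** [decided toy]: one scale above the births the met component carries ALL `Lb⁴` families of
birth scale `0`, and `Lb⁴ = 1·(Lb⁴)^{1−0}` — the positional count of (w3-book) L-C holds with EQUALITY on the toy (`K ≥ 1`). [folklore] -/
theorem count_attained {K Lb : ℕ} (hK : 1 ≤ K) (b : Blk Lb) :
    (((SP K Lb 1 b).filter fun f => (BP K Lb).birthScale f = 0).card : ℝ) = 1 * ((Lb : ℝ) ^ 4) ^ (1 - 0) := by
  have h1 : ((SP K Lb 1 b).filter fun f => (BP K Lb).birthScale f = 0) = SP K Lb 1 b :=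
    Finset.filter_true_of_mem fun _ _ => rfl
  have h2 : ((SP K Lb 1 b).filter fun f => (BP K Lb).birthScale f = 0).card = Lb ^ 4 :=
    (congrArg Finset.card h1).trans (liveFamilies_card le_rfl hK b)
  have h3 : (((SP K Lb 1 b).filter fun f => (BP K Lb).birthScale f = 0).card : ℝ) = (Lb : ℝ) ^ 4 := by
    exact_mod_cast h2
  rw [h3]; norm_num

/-! ## §3 THE TERMINAL FACE FIRES on the `Lb⁴`-family tower at every integer of the window [decided toy] -/

/-- **THE BLOCK GEOMETRY ACTS AND THE TERMINAL FACE FIRES — S3l's `dressedStabilityWith_of_canonicalSliceWinSchedules` APPLIED TO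
THE `Lb⁴`-FAMILY TOWER AT EVERY INTEGER BLOCKING FACTOR `81 ≤ Lb ≤ 120`** [decided toy]: the canonical terminal face's ≈ 50
`(a, K)`-indexed binder families — (w1) `hsl`, H2 `hFn`∕`h𝒢`∕`hQ`∕`hSg`∕`hmeas`, (w2-act) `hB`∕`hE`∕`hs₀`, (I4′)
`hδf`∕`hδfwk`∕`hpairx`∕`hdefwk`∕`hrate` + `hcm`, F-9 `hinv`∕`hDμ`∕`hz₁`, the booking convention `hne`∕`hsup`, (w5) `hc0`∕`hcb`∕`hreg`,
the anchoring DATA `Anch := anchP K Lb` (coarsening ACTING) ∕ `hLb := rfl` ∕ `hmult` ∕ `hscale` ∕ `hhoused` (all `Lb⁴` families housed in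
ONE cube) ∕ `hvol`, the absorption DATA `holder`∕`hsub`∕`habs`∕`hβ`, ONE cutoff-free schedule `Wm` (ratio `κ = ½`), and the located
scalars `(κ, L, c̄, N₀, A₀, s̄⁰, ρ′, r, c_δ, m, v, mB, A, β₀) = (½, Lb, 0, 1, 1, 0, ¾, 1, ½, ¼, 1, 1, 0, 1)` bound ONCE — inhabited AT
ONCE; conclusion: class amplitude `1`, family factor `rhoOne Lb⁻² 2 0 ½ = 3e³∕Lb²`, source decay `Lb⁻³`, with `Lb⁴` live families per
met component counted by the anchoring INSIDE the face.  Non-vacuity of binder SHAPES; nothing of Bałaban's densities; NE1′ NOT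
proved. [folklore] -/
theorem dressedStabilityWith_towerP_fires {Lb : ℕ} (h81 : 81 ≤ Lb) (h120 : Lb ≤ 120) :
    DressedStabilityWith (towerP Lb) 1 (rhoOne ((Lb : ℝ) ^ 2)⁻¹ (4 * (1 / 2) / 1) 0 (1 / 2)) ((Lb : ℝ)⁻¹ ^ 3) :=
  have hLb1 : 1 ≤ Lb := le_trans (by norm_num) h81
  dressedStabilityWith_of_canonicalSliceWinSchedules (towerP Lb) (κ := 1 / 2) (L := (Lb : ℝ)) (cbar := 0) (N₀ := 1) (A₀ := 1)
    (sbar := 0) (ρ' := 3 / 4) (r := 1) (cδ := 1 / 2) (m := 1 / 4) (w := fun _ _ => 1) (fun _ _ => Wm) (by norm_num)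
    (Fn := fun _ K _ k' k => FnM K k' k) (rel := fun _ _ _ _ _ U U' => U = U') (ref := fun _ _ _ _ U => U)
    (base := fun _ _ _ _ => base₁) (𝒜 := fun _ _ _ _ => zeroExp) (𝒬 := fun _ K _ k => 𝒬T K k) (q := fun _ _ _ _ _ => 0)
    (μ := fun _ _ _ k => flAt (atomW (k + 1))) (z₀ := fun _ _ _ _ => 0) (z₁ := fun _ _ _ _ => 0)
    (defect := fun _ _ _ _ k => defW (k + 1)) (s := fun _ _ _ _ => 0) (S := fun _ K k b => SP K Lb k b)
    (Sg := fun _ K k b => SgP K Lb k b) (c := fun _ _ _ k => cP Lb k) (δf := fun _ _ _ k _ => dfW k)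
    (creg := fun _ _ _ => 0) (mB := 1) (v := 1) (fun _ K => anchP K Lb) (comp := fun _ K k b => compP K Lb k b)
    (Sabs := fun _ _ _ => ∅) (β := fun _ K _ => (LW⁻¹ ^ 3) ^ K) (A := 0) (β₀ := 1)
    (fun _ _ => hratioM) (one_le_natL h81) le_rfl zero_le_one zero_le_one (by norm_num) (hloc_int h81) hρ'_int hsmall_int one_pos
    (by norm_num)
    (fun _ K b k' _ _ _ => birthSlice_anti_window (hslP K Lb b k') (Wm.hwcw k'))
    (fun _ K _ k' k _ _ hk _ U => hFnT K k' k hk U) (fun _ _ _ _ k _ _ _ _ _ => mem_bddClass_flAt _ _)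
    (fun _ _ _ _ k _ _ _ _ => realBaseAt_W _ _) (fun _ _ _ _ k _ _ _ _ => exponentSliceAt_M _ _ _ _)
    (fun _ K b k x hx => hδfP h81 h120 K k b x hx) (fun _ _ _ k => hDμM k) (fun _ _ _ k => hz₁M k)
    (fun _ _ _ _ k _ _ _ _ U₀ _ pd _ _ => (relGauge_pairs k).mono fun z hz t _ => hz (latMove U₀ pd t))
    (fun _ _ _ _ _ _ _ h => h ▸ rfl) (fun _ _ _ _ _ k _ => aesm_flAt _ _) (fun _ _ _ _ k => hdefwkM k)
    (fun _ _ _ k' k _ _ _ => hrateT h81 h120 k' k) (fun _ _ _ _ k _ _ _ _ => hneM k)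
    (fun _ K b k' k _ _ _ _ => hsupP K Lb b k' k) (fun _ _ _ => le_rfl) (fun _ _ _ _ => le_rfl) (fun _ K => hregP K Lb _)
    (fun _ _ _ _ => le_rfl) rfl (fun _ K => hmultP K Lb) (fun _ K => hscaleP K Lb) (fun _ K => hhousedP K Lb)
    (fun _ K => hvolP K Lb) (fun _ _ _ _ h => absurd h (Finset.notMem_empty _)) (fun _ _ _ => Finset.empty_subset _)
    (fun _ K => habsP K Lb _ _) (fun _ K j _ => tau_pow_le h81 h120 K j) (fun _ K b k => hQP K hpos' b k) (fun _ K => hSgP K Lb)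
    (fun _ _ _ k => hcmP hLb1 k) (fun _ _ _ k _ _ => hδfwkM k) hvN₀_int le_rfl hfan_int hamp_int
where
  /-- [folklore] the blocking integer is positive (for the dictionary's `Lb⁴ ≠ 0`) -/
  hpos' : 0 < Lb := lt_of_lt_of_le Nat.zero_lt_one (le_trans (by norm_num) h81)

/-- **THE ROW ROOT `DressedStability (towerP Lb)` OUT OF THE CANONICAL TERMINAL FACE** [decided toy], at every integer of the window
(the face's existential form is exactly this packaging of the With-form). [folklore] -/
theorem dressedStability_towerP_fires {Lb : ℕ} (h81 : 81 ≤ Lb) (h120 : Lb ≤ 120) : DressedStability (towerP Lb) :=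
  ⟨_, _, _, dressedStabilityWith_towerP_fires h81 h120⟩

/-- [decided toy] END's consumer face at every cutoff: every booked size of every one of the `Lb⁴` families is below the two-rate
profile `twoRate 1 (3e³∕Lb²) Lb⁻³ K`. [folklore] -/
theorem sizeBound_towerP_fires {Lb : ℕ} (h81 : 81 ≤ Lb) (h120 : Lb ≤ 120) (p : Unit) (K : ℕ) :
    ((towerP Lb).B p K).SizeBound
      (twoRate 1 (rhoOne ((Lb : ℝ) ^ 2)⁻¹ (4 * (1 / 2) / 1) 0 (1 / 2)) ((Lb : ℝ)⁻¹ ^ 3) ((towerP Lb).B p K).K) :=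
  sizeBound_of_dressedStabilityWith (dressedStabilityWith_towerP_fires h81 h120) p K

/-- **ROOT-B OUT OF THE CANONICAL TERMINAL FACE** [decided toy]: for every run-weight family `0 ≤ wt () K j ≤ w̄` and every integer of
the window, `DressedBudget (towerP Lb) wt` by S3l's `dressedBudget_of_canonicalSliceWinSchedules` BY NAME — the SAME anchoring read as
the bookings' positional count (`positionalCount_of_anchoring_cell` inside the face: up to `Lb⁴` families of scale `0` felt at a
cube one scale up, counted by the box fibres of `card_feltSet_le`), the whole binder list inhabited at once. [folklore] -/
theorem dressedBudget_towerP_fires {Lb : ℕ} (h81 : 81 ≤ Lb) (h120 : Lb ≤ 120) {wbar : ℝ} {wt : Unit → ℕ → ℕ → ℝ}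
    (hwbar : 0 ≤ wbar) (hw0 : ∀ p K, ∀ j ≤ K, 0 ≤ wt p K j) (hwb : ∀ p K, ∀ j ≤ K, wt p K j ≤ wbar) :
    DressedBudget (towerP Lb) wt :=
  have hLb1 : 1 ≤ Lb := le_trans (by norm_num) h81
  dressedBudget_of_canonicalSliceWinSchedules (towerP Lb) (κ := 1 / 2) (L := (Lb : ℝ)) (cbar := 0) (N₀ := 1) (A₀ := 1)
    (sbar := 0) (ρ' := 3 / 4) (r := 1) (cδ := 1 / 2) (m := 1 / 4) (w := fun _ _ => 1) (fun _ _ => Wm) (by norm_num)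
    (Fn := fun _ K _ k' k => FnM K k' k) (rel := fun _ _ _ _ _ U U' => U = U') (ref := fun _ _ _ _ U => U)
    (base := fun _ _ _ _ => base₁) (𝒜 := fun _ _ _ _ => zeroExp) (𝒬 := fun _ K _ k => 𝒬T K k) (q := fun _ _ _ _ _ => 0)
    (μ := fun _ _ _ k => flAt (atomW (k + 1))) (z₀ := fun _ _ _ _ => 0) (z₁ := fun _ _ _ _ => 0)
    (defect := fun _ _ _ _ k => defW (k + 1)) (s := fun _ _ _ _ => 0) (S := fun _ K k b => SP K Lb k b)
    (Sg := fun _ K k b => SgP K Lb k b) (c := fun _ _ _ k => cP Lb k) (δf := fun _ _ _ k _ => dfW k)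
    (creg := fun _ _ _ => 0) (mB := 1) (v := 1) (fun _ K => anchP K Lb) (comp := fun _ K k b => compP K Lb k b)
    (Sabs := fun _ _ _ => ∅) (β := fun _ K _ => (LW⁻¹ ^ 3) ^ K) (A := 0) (β₀ := 1)
    (fun _ _ => hratioM) (one_le_natL h81) le_rfl zero_le_one zero_le_one (by norm_num) (hloc_int h81) hρ'_int hsmall_int one_pos
    (by norm_num)
    (fun _ K b k' _ _ _ => birthSlice_anti_window (hslP K Lb b k') (Wm.hwcw k'))
    (fun _ K _ k' k _ _ hk _ U => hFnT K k' k hk U) (fun _ _ _ _ k _ _ _ _ _ => mem_bddClass_flAt _ _)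
    (fun _ _ _ _ k _ _ _ _ => realBaseAt_W _ _) (fun _ _ _ _ k _ _ _ _ => exponentSliceAt_M _ _ _ _)
    (fun _ K b k x hx => hδfP h81 h120 K k b x hx) (fun _ _ _ k => hDμM k) (fun _ _ _ k => hz₁M k)
    (fun _ _ _ _ k _ _ _ _ U₀ _ pd _ _ => (relGauge_pairs k).mono fun z hz t _ => hz (latMove U₀ pd t))
    (fun _ _ _ _ _ _ _ h => h ▸ rfl) (fun _ _ _ _ _ k _ => aesm_flAt _ _) (fun _ _ _ _ k => hdefwkM k)
    (fun _ _ _ k' k _ _ _ => hrateT h81 h120 k' k) (fun _ _ _ _ k _ _ _ _ => hneM k)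
    (fun _ K b k' k _ _ _ _ => hsupP K Lb b k' k) (fun _ _ _ => le_rfl) (fun _ _ _ _ => le_rfl) (fun _ K => hregP K Lb _)
    (fun _ _ _ _ => le_rfl) rfl (fun _ K => hmultP K Lb) (fun _ K => hscaleP K Lb) (fun _ K => hhousedP K Lb)
    (fun _ K => hvolP K Lb) (fun _ _ _ _ h => absurd h (Finset.notMem_empty _)) (fun _ _ _ => Finset.empty_subset _)
    (fun _ K => habsP K Lb _ _) (fun _ K j _ => tau_pow_le h81 h120 K j) (fun _ K b k => hQP K hpos' b k) (fun _ K => hSgP K Lb)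
    (fun _ _ _ k => hcmP hLb1 k) (fun _ _ _ k _ _ => hδfwkM k) hvN₀_int le_rfl hfan_int hamp_int hwbar hw0 hwb le_rfl
where
  /-- [folklore] the blocking integer is positive (for the dictionary's `Lb⁴ ≠ 0`) -/
  hpos' : 0 < Lb := lt_of_lt_of_le Nat.zero_lt_one (le_trans (by norm_num) h81)

/-- [decided toy] The closed instance: unit run weights at the least integer of the window, `81⁴ = 43 046 721` families per met
component. [folklore] -/
example : DressedBudget (towerP 81) fun _ _ _ => 1 :=
  dressedBudget_towerP_fires (Lb := 81) le_rfl (by norm_num) (wbar := 1) zero_le_one (fun _ _ _ _ => zero_le_one)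
    fun _ _ _ _ => le_rfl

/-- [decided toy] The window is inhabited at both ends: the terminal face fires on the `81⁴`-family tower … [folklore] -/
example : DressedStability (towerP 81) := dressedStability_towerP_fires le_rfl (by norm_num)

/-- [decided toy] … and on the `120⁴`-family tower. [folklore] -/
example : DressedStability (towerP 120) := dressedStability_towerP_fires (by norm_num) le_rfl

end Summit.QuantumFields.BalabanUV.T4Continuum.NE1p.DressedTowerWitnessBlocks

end
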